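import Literature.NumberTheory.Automorphic.GaloisActionAdeleRing
import Literature.NumberTheory.Automorphic.AdeleBaseChange
import Literature.NumberTheory.GaloisRepresentations.HeckeCharacter
import HarnessLib

/-!
# The norm group `F^× N(𝔸_E^×)` and the class-field character `η` of `E/F`

Topic `NumberTheory/Automorphic` (infrastructure for base change, Arthur–Clozel Ch. 3: the
character `η` of Thm. 4.2, "a character of `𝔸^*` vanishing exactly on `F^* N(𝔸_E^*)`", and the
characters `χ` of `F^* N(𝔸_E^*)∖𝔸^*` of Thm. 3.1); namespace `Literature.Automorphic`, dot-notation
extensions of `Literature.NumberTheory.GaloisRepresentations.HeckeCharacter`. Everything **proved** (definitions + API); no named facts.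

* `AdeleRing.smul_baseChange`: **`Aut(E/F)` fixes `𝔸_F ⊆ 𝔸_E`** (`σ • x_E = x_E` for the base
  change `AdeleRing.baseChange` of `AdeleBaseChange`), from the local statements
  `galAdicCompletionMap_adicCompletionOfLiesOver` / `galInfiniteCompletionMap_completionMap`
  (`σ_w ∘ (F_v → E_w) = (F_v → E_{σ w})`: continuous extensions of `F → E` agreeing on the dense
  `F`; Cassels–Fröhlich VII §1.1, "`σ_w` is a `K_v`-isomorphism"); the action of `Aut(E/F)` on the
  idele group `𝔸_Eˣ` (instance `instMulDistribMulActionIdeleGroup`, Mathlib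
  `Units.mulDistribMulActionRight`).
* `AdeleRing.ideleGalNorm F E : 𝔸_Eˣ →* 𝔸_Eˣ`, `y ↦ ∏_{σ ∈ Aut(E/F)} σ • y` — for `E/F` Galois the
  idelic norm `N_{E/F}`, kept inside `𝔸_Eˣ` (so no descent statement is needed to *state* norm
  groups); `Aut(E/F)`-invariance, `N (σ y) = N y`, and **`N(x_E) = x_E ^ #Aut(E/F)`** for ideles of
  `F` (`ideleGalNorm_ideleBaseChange`).
* `idelicNormSubgroup F E ≤ 𝔸_Fˣ` (the `x` with `x_E` a norm), **`normGroup F E = F^× N(𝔸_E^×)`**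
  (`principalIdeles F ⊔ idelicNormSubgroup F E`), `pow_card_mem_normGroup` (`x ^ #Aut(E/F)` is a
  norm);
* `HeckeCharacter.IsTrivialOnNormGroup E χ` (Thm. 3.1's `χ`) and
  **`HeckeCharacter.IsClassFieldCharacter E η`** (`η x = 1 ↔ x ∈ normGroup F E`, Thm. 4.2's `η`),
  with the proved consequences: closure under products/powers, `χ ^ #Aut(E/F) = 1`
  (`pow_card`), hence finite order and unitarity (`isFiniteOrder`, `isUnitary` — the side
  conditions of the twists `π ⊗ χ` of `AutomorphicTwist`), and `η ≠ 1` as soon as some idele is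
  not in the norm group.

Existence of `η` for cyclic `E/F` is class field theory (Takagi–Artin; Cassels–Fröhlich VII
§5.1 (B)) and is recorded as a named fact in the statements file `ArthurClozelBaseChange`.

## References

* J. Arthur, L. Clozel, *Simple algebras, base change, and the advanced theory of the trace
  formula*, Ann. of Math. Stud. 120 (1989), Ch. 3, Thm. 3.1 and §4 (before Thm. 4.2).
  [ArthurClozelAMS120]
* J. W. S. Cassels, A. Fröhlich (eds.), *Algebraic Number Theory* (1967), Ch. VII (Tate), §1.1,
  §4.4, §5.1. [CasselsFrohlichANT1967]
-/

noncomputable section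

open IsDedekindDomain

namespace Literature.NumberTheory.Automorphic

/-! ## `Gal(E/F)` fixes `𝔸_F ⊆ 𝔸_E`; the norm `N(𝔸_E^×)`; the class-field character `η` -/

section GaloisFixesBase

open NumberField

variable (F : Type*) {E : Type*} [Field F] [Field E] [Algebra F E]

/-- Transport of the local base-change map along an equality of places below (for dependent
families; `LiesOver` instances are propositions). [folklore] -/
theorem adicCompletionOfLiesOver_congr [NumberField F] [NumberField E] {v v' : HeightOneSpectrum (𝓞 F)} (hv : v = v')
    (w : HeightOneSpectrum (𝓞 E)) [i : w.asIdeal.LiesOver v.asIdeal] [i' : w.asIdeal.LiesOver v'.asIdeal]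
    (x : ∀ u : HeightOneSpectrum (𝓞 F), u.adicCompletion F) :
    adicCompletionOfLiesOver F E v w (x v) = adicCompletionOfLiesOver F E v' w (x v') := by
  subst hv; rfl

/-- **`σ` commutes with the local base-change maps**: `σ_{w₁} ∘ (F_v → E_{w₁}) = (F_v → E_{w₂})`
for `σ • w₁ = w₂` (both are continuous ring homomorphisms `F_v → E_{w₂}` extending `F → E`,
`σ` fixing `F`). Cassels–Fröhlich VII §1.1: "`σ_w` is a `K_v`-isomorphism". [folklore] -/
theorem galAdicCompletionMap_adicCompletionOfLiesOver [NumberField F] [NumberField E] (σ : E ≃ₐ[F] E)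
    (v : HeightOneSpectrum (𝓞 F)) {w₁ w₂ : HeightOneSpectrum (𝓞 E)} [w₁.asIdeal.LiesOver v.asIdeal]
    [w₂.asIdeal.LiesOver v.asIdeal] (h : σ • w₁ = w₂) (y : v.adicCompletion F) :
    galAdicCompletionMap σ h (adicCompletionOfLiesOver F E v w₁ y) = adicCompletionOfLiesOver F E v w₂ y := by
  refine congrFun (HeightOneSpectrum.adicCompletion.ext_of_coe F v
    ((continuous_galAdicCompletionMap E σ h).comp (continuous_adicCompletionOfLiesOver F E v w₁))
    (continuous_adicCompletionOfLiesOver F E v w₂) fun a => ?_) y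
  simp only [Function.comp_apply, adicCompletionOfLiesOver_coe, galAdicCompletionMap_coe_algEquiv,
    AlgEquiv.commutes]

/-- `σ` commutes with the local base-change maps at infinite places. [folklore] -/
theorem galInfiniteCompletionMap_completionMap (σ : E ≃ₐ[F] E) (v : InfinitePlace F)
    {w₁ w₂ : InfinitePlace E} [i₁ : w₁.1.LiesOver v.1] [i₂ : w₂.1.LiesOver v.1] (h : σ • w₁ = w₂)
    (y : v.Completion) :
    galInfiniteCompletionMap σ h (NumberField.LiesOver.completionMap (w := w₁) y) =
      NumberField.LiesOver.completionMap (w := w₂) y := by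
  refine congrFun (InfinitePlace.Completion.ext_of_coe v
    ((continuous_galInfiniteCompletionMap F σ h).comp NumberField.LiesOver.continuous_completionMap)
    NumberField.LiesOver.continuous_completionMap fun a => ?_) y
  simp only [Function.comp_apply]
  change galInfiniteCompletionMap σ h (NumberField.LiesOver.completionMap
    ((WithAbs.toAbs v.1 a : WithAbs v.1) : v.Completion)) =
    NumberField.LiesOver.completionMap ((WithAbs.toAbs v.1 a : WithAbs v.1) : v.Completion)
  rw [NumberField.LiesOver.completionMap_coe, NumberField.LiesOver.completionMap_coe]
  change galInfiniteCompletionMap σ h ((algebraMap F E a : E) : w₁.Completion) =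
    ((algebraMap F E a : E) : w₂.Completion)
  rw [galInfiniteCompletionMap_coe, AlgEquiv.commutes]

/-- `infiniteCompletionOfComap w` is Mathlib's `completionMap` for any place `v = w|_F` below and any
`LiesOver` instance (transport along `hv`, proof irrelevance). [folklore] -/
theorem infiniteCompletionOfComap_eq (w : InfinitePlace E) {v : InfinitePlace F} [i : w.1.LiesOver v.1]
    (hv : w.comap (algebraMap F E) = v) (x : ∀ u : InfinitePlace F, u.Completion) :
    infiniteCompletionOfComap F E w (x (w.comap (algebraMap F E))) =
      NumberField.LiesOver.completionMap (v := v) (w := w) (x v) := by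
  subst hv; rfl

/-- `adicCompletionOfUnder w` is `adicCompletionOfLiesOver v w` for any place `v = w ∩ 𝓞 F` below and
any `LiesOver` instance. [folklore] -/
theorem adicCompletionOfUnder_eq [NumberField F] [NumberField E] (w : HeightOneSpectrum (𝓞 E))
    {v : HeightOneSpectrum (𝓞 F)} [i : w.asIdeal.LiesOver v.asIdeal] (hv : w.under (𝓞 F) = v)
    (x : ∀ u : HeightOneSpectrum (𝓞 F), u.adicCompletion F) :
    adicCompletionOfUnder (𝓞 F) F E w (x (w.under (𝓞 F))) = adicCompletionOfLiesOver F E v w (x v) := by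
  subst hv; rfl

omit [Algebra F E] in
/-- For `σ ∈ Aut(E/F)`, `(σ • w)|_F = w|_F` on infinite places. [folklore] -/
theorem InfinitePlace.comap_algEquiv_smul [Algebra F E] (σ : E ≃ₐ[F] E) (w : InfinitePlace E) :
    (σ • w).comap (algebraMap F E) = w.comap (algebraMap F E) := by
  rw [InfinitePlace.comap_smul]
  congr 1
  exact RingHom.ext fun a => σ.symm.commutes a

variable (E) in
/-- **`Aut(E/F)` fixes `𝔸_F ⊆ 𝔸_E`**: `σ • x_E = x_E` for the base change `x_E` of an adele of `F`.
[folklore] -/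
@[simp] theorem AdeleRing.smul_baseChange [NumberField F] [NumberField E] (σ : E ≃ₐ[F] E)
    (x : AdeleRing (𝓞 F) F) : σ • AdeleRing.baseChange F E x = AdeleRing.baseChange F E x := by
  refine Prod.ext (funext fun w => ?_) (FiniteAdeleRing.ext E fun w => ?_)
  · -- infinite places
    rw [AdeleRing.smul_fst, AdeleRing.baseChange_fst, InfiniteAdeleRing.smul_apply,
      InfiniteAdeleRing.baseChange_apply, InfiniteAdeleRing.baseChange_apply]
    set v := w.comap (algebraMap F E) with hvdef
    have hv : (σ⁻¹ • w).comap (algebraMap F E) = v := InfinitePlace.comap_algEquiv_smul F σ⁻¹ w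
    haveI i₁ : (σ⁻¹ • w).1.LiesOver v.1 := ⟨congrArg Subtype.val hv⟩
    haveI i₂ : w.1.LiesOver v.1 := ⟨rfl⟩
    rw [infiniteCompletionOfComap_eq F (σ⁻¹ • w) (i := i₁) hv x.1,
      infiniteCompletionOfComap_eq F w (i := i₂) rfl x.1]
    exact galInfiniteCompletionMap_completionMap F σ v (i₁ := i₁) (i₂ := i₂) (smul_inv_smul σ w) (x.1 v)
  · -- finite places
    rw [AdeleRing.smul_snd, AdeleRing.baseChange_snd, FiniteAdeleRing.smul_apply,
      FiniteAdeleRing.baseChange_apply, FiniteAdeleRing.baseChange_apply]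
    set v := w.under (𝓞 F) with hvdef
    have hv : (σ⁻¹ • w).under (𝓞 F) = v := HeightOneSpectrum.under_algEquiv_smul F E σ⁻¹ w
    haveI i₁ : (σ⁻¹ • w).asIdeal.LiesOver v.asIdeal := ⟨(congrArg HeightOneSpectrum.asIdeal hv).symm⟩
    haveI i₂ : w.asIdeal.LiesOver v.asIdeal := ⟨rfl⟩
    rw [adicCompletionOfUnder_eq F (σ⁻¹ • w) (i := i₁) hv (⇑x.2),
      adicCompletionOfUnder_eq F w (i := i₂) rfl (⇑x.2)]
    exact galAdicCompletionMap_adicCompletionOfLiesOver F σ v (smul_inv_smul σ w) (x.2 v)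

/-- **`Aut(E/F)` acts on the idele group `𝔸_Eˣ`** (Mathlib `Units.mulDistribMulActionRight`
of the action on `𝔸_E`; `(σ • u : 𝔸_E) = σ • (u : 𝔸_E)`). A new instance. [folklore] -/
instance instMulDistribMulActionIdeleGroup [NumberField E] :
    MulDistribMulAction (E ≃ₐ[F] E) (AdeleRing (𝓞 E) E)ˣ :=
  Units.mulDistribMulActionRight

/-- `(σ • u : 𝔸_E) = σ • (u : 𝔸_E)` for ideles (definitional). [folklore] -/
@[simp] theorem AdeleRing.coe_smul_units [NumberField E] (σ : E ≃ₐ[F] E) (u : (AdeleRing (𝓞 E) E)ˣ) :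
    ((σ • u : (AdeleRing (𝓞 E) E)ˣ) : AdeleRing (𝓞 E) E) = σ • (u : AdeleRing (𝓞 E) E) := rfl

variable (E) in
/-- `σ • x_E = x_E` on ideles. [folklore] -/
@[simp] theorem AdeleRing.smul_ideleBaseChange [NumberField F] [NumberField E] (σ : E ≃ₐ[F] E)
    (x : (AdeleRing (𝓞 F) F)ˣ) :
    σ • AdeleRing.ideleBaseChange F E x = AdeleRing.ideleBaseChange F E x :=
  Units.ext (AdeleRing.smul_baseChange F E σ x)

end GaloisFixesBase

/-! ### The norm group `F^× N(𝔸_E^×)` and the class-field character `η` -/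

section ClassFieldCharacter

open NumberField

variable (F E : Type*) [Field F] [Field E] [Algebra F E] [NumberField F] [NumberField E]
  [FiniteDimensional F E]

/-- **The Galois norm on ideles of `E`**: `N y = ∏_{σ ∈ Aut(E/F)} σ • y ∈ 𝔸_Eˣ`. For `E/F` Galois
this is the idelic norm `N_{E/F} : 𝔸_E^× → 𝔸^× ⊆ 𝔸_E^×` (Cassels–Fröhlich, Ch. II §11 and Ch. VII
§1–§2; Arthur–Clozel, Ch. 3 §4, `N(𝔸_E^*)`), kept inside `𝔸_E^×` so that no descent statement is
needed to *state* the norm group. [folklore] -/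
def AdeleRing.ideleGalNorm : (AdeleRing (𝓞 E) E)ˣ →* (AdeleRing (𝓞 E) E)ˣ where
  toFun y := ∏ σ : E ≃ₐ[F] E, σ • y
  map_one' := by simp
  map_mul' y z := by rw [← Finset.prod_mul_distrib]; exact Finset.prod_congr rfl fun σ _ => smul_mul' σ y z

omit [NumberField F] in
/-- `N y = ∏_σ σ • y` (definitional). [folklore] -/
theorem AdeleRing.ideleGalNorm_apply (y : (AdeleRing (𝓞 E) E)ˣ) :
    AdeleRing.ideleGalNorm F E y = ∏ σ : E ≃ₐ[F] E, σ • y := rfl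

omit [NumberField F] in
/-- The norm is `Aut(E/F)`-invariant: `τ • N y = N y` (reindex the product). [folklore] -/
@[simp] theorem AdeleRing.smul_ideleGalNorm (τ : E ≃ₐ[F] E) (y : (AdeleRing (𝓞 E) E)ˣ) :
    τ • AdeleRing.ideleGalNorm F E y = AdeleRing.ideleGalNorm F E y := by
  rw [AdeleRing.ideleGalNorm_apply, Finset.smul_prod']
  simp_rw [smul_smul]
  exact Fintype.prod_equiv (Equiv.mulLeft τ) _ _ fun σ => rfl

omit [NumberField F] in
/-- The norm of a conjugate: `N (τ • y) = N y`. [folklore] -/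
@[simp] theorem AdeleRing.ideleGalNorm_smul (τ : E ≃ₐ[F] E) (y : (AdeleRing (𝓞 E) E)ˣ) :
    AdeleRing.ideleGalNorm F E (τ • y) = AdeleRing.ideleGalNorm F E y := by
  rw [AdeleRing.ideleGalNorm_apply, AdeleRing.ideleGalNorm_apply]
  simp_rw [smul_smul]
  exact Fintype.prod_equiv (Equiv.mulRight τ) _ _ fun σ => rfl

/-- **The norm of an idele of `F` is its `[Aut(E/F)]`-th power**: `N (x_E) = x_E ^ #Aut(E/F)`
(`σ` fixes `𝔸_F`). [folklore] -/
theorem AdeleRing.ideleGalNorm_ideleBaseChange (x : (AdeleRing (𝓞 F) F)ˣ) :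
    AdeleRing.ideleGalNorm F E (AdeleRing.ideleBaseChange F E x) =
      AdeleRing.ideleBaseChange F E x ^ Fintype.card (E ≃ₐ[F] E) := by
  rw [AdeleRing.ideleGalNorm_apply]
  simp_rw [AdeleRing.smul_ideleBaseChange]
  rw [Finset.prod_const, Finset.card_univ]

/-- **The group of norms** `N(𝔸_E^×) ∩ 𝔸_F^×`, as a subgroup of the ideles of `F`: the `x ∈ 𝔸_Fˣ`
whose image in `𝔸_Eˣ` is a norm `∏_σ σ • y`. [folklore] -/
def idelicNormSubgroup : Subgroup (AdeleRing (𝓞 F) F)ˣ :=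
  (AdeleRing.ideleGalNorm F E).range.comap (AdeleRing.ideleBaseChange F E)

variable {F E} in
/-- Membership in the group of norms (definitional). [folklore] -/
theorem mem_idelicNormSubgroup_iff {x : (AdeleRing (𝓞 F) F)ˣ} :
    x ∈ idelicNormSubgroup F E ↔
      ∃ y : (AdeleRing (𝓞 E) E)ˣ, AdeleRing.ideleGalNorm F E y = AdeleRing.ideleBaseChange F E x :=
  Iff.rfl

/-- Every `#Aut(E/F)`-th power of an idele of `F` is a norm. [folklore] -/
theorem pow_card_mem_idelicNormSubgroup (x : (AdeleRing (𝓞 F) F)ˣ) :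
    x ^ Fintype.card (E ≃ₐ[F] E) ∈ idelicNormSubgroup F E :=
  ⟨AdeleRing.ideleBaseChange F E x, by rw [AdeleRing.ideleGalNorm_ideleBaseChange, map_pow]⟩

/-- **The norm group `F^× N(𝔸_E^×)`** of `E/F` inside the ideles of `F` (Arthur–Clozel, Ch. 3 §4:
"`η` a character of `𝔸^*` vanishing exactly on `F^* N(𝔸_E^*)`"; Cassels–Fröhlich, Ch. VII §4–§5).
[cite: ArthurClozelAMS120, Ch. 3 §4 (before Thm. 4.2)] -/
def normGroup : Subgroup (AdeleRing (𝓞 F) F)ˣ :=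
  Literature.NumberTheory.GaloisRepresentations.principalIdeles F ⊔ idelicNormSubgroup F E

/-- `F^× ≤ F^× N(𝔸_E^×)`. [folklore] -/
theorem principalIdeles_le_normGroup : Literature.NumberTheory.GaloisRepresentations.principalIdeles F ≤ normGroup F E := le_sup_left

/-- `N(𝔸_E^×) ≤ F^× N(𝔸_E^×)`. [folklore] -/
theorem idelicNormSubgroup_le_normGroup : idelicNormSubgroup F E ≤ normGroup F E := le_sup_right

/-- `x ^ #Aut(E/F) ∈ F^× N(𝔸_E^×)` for every idele `x` of `F`. [folklore] -/
theorem pow_card_mem_normGroup (x : (AdeleRing (𝓞 F) F)ˣ) :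
    x ^ Fintype.card (E ≃ₐ[F] E) ∈ normGroup F E :=
  idelicNormSubgroup_le_normGroup F E (pow_card_mem_idelicNormSubgroup F E x)

variable {F}

/-- `χ` is **trivial on the norm group** `F^× N(𝔸_E^×)` (a character of
`𝔸^*/F^* N(𝔸_E^*)`; Arthur–Clozel, Ch. 3, Thm. 3.1: "`χ` is a character of `F^* N(𝔸_E^*)∖𝔸^*`").
[cite: ArthurClozelAMS120, Ch. 3, Thm. 3.1] -/
def _root_.Literature.NumberTheory.GaloisRepresentations.HeckeCharacter.IsTrivialOnNormGroup (χ : Literature.NumberTheory.GaloisRepresentations.HeckeCharacter F) : Prop :=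
  ∀ x ∈ normGroup F E, χ x = 1

/-- **`η` is a class-field character of `E/F`**: a Hecke character of `F` "vanishing exactly on
`F^* N(𝔸_E^*)`" (Arthur–Clozel, Ch. 3 §4, the character `η` of Thm. 4.2; for `E/F` cyclic of prime
degree `ℓ` these are the `ℓ - 1` characters of `𝔸^*/F^* N(𝔸_E^*) ≅ Gal(E/F)` of exact order `ℓ`,
by the reciprocity isomorphism of class field theory, Cassels–Fröhlich VII §5.1). Only the
definition is given here; existence is class field theory (`exists_isClassFieldCharacter` of the
sibling statements file). [cite: ArthurClozelAMS120, Ch. 3 §4 (before Thm. 4.2)] -/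
def _root_.Literature.NumberTheory.GaloisRepresentations.HeckeCharacter.IsClassFieldCharacter (η : Literature.NumberTheory.GaloisRepresentations.HeckeCharacter F) : Prop :=
  ∀ x : (AdeleRing (𝓞 F) F)ˣ, η x = 1 ↔ x ∈ normGroup F E

variable {E}

/-- A class-field character is trivial on the norm group. [folklore] -/
theorem _root_.Literature.NumberTheory.GaloisRepresentations.HeckeCharacter.IsClassFieldCharacter.isTrivialOnNormGroup {η : Literature.NumberTheory.GaloisRepresentations.HeckeCharacter F}
    (h : η.IsClassFieldCharacter E) : η.IsTrivialOnNormGroup E :=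
  fun x hx => (h x).mpr hx

/-- The trivial character is trivial on the norm group. [folklore] -/
theorem _root_.Literature.NumberTheory.GaloisRepresentations.HeckeCharacter.isTrivialOnNormGroup_one :
    (1 : Literature.NumberTheory.GaloisRepresentations.HeckeCharacter F).IsTrivialOnNormGroup E :=
  fun _ _ => rfl

/-- Characters trivial on the norm group form a subgroup: products. [folklore] -/
theorem _root_.Literature.NumberTheory.GaloisRepresentations.HeckeCharacter.IsTrivialOnNormGroup.mul {χ ψ : Literature.NumberTheory.GaloisRepresentations.HeckeCharacter F}
    (hχ : χ.IsTrivialOnNormGroup E) (hψ : ψ.IsTrivialOnNormGroup E) : (χ * ψ).IsTrivialOnNormGroup E :=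
  fun x hx => by rw [Literature.NumberTheory.GaloisRepresentations.HeckeCharacter.mul_apply, hχ x hx, hψ x hx, mul_one]

/-- Characters trivial on the norm group form a subgroup: powers. [folklore] -/
theorem _root_.Literature.NumberTheory.GaloisRepresentations.HeckeCharacter.IsTrivialOnNormGroup.pow {χ : Literature.NumberTheory.GaloisRepresentations.HeckeCharacter F}
    (hχ : χ.IsTrivialOnNormGroup E) (i : ℕ) : (χ ^ i).IsTrivialOnNormGroup E :=
  fun x hx => by rw [Literature.NumberTheory.GaloisRepresentations.HeckeCharacter.pow_apply, hχ x hx, one_pow]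

/-- **A character trivial on `F^× N(𝔸_E^×)` is killed by `#Aut(E/F)`**: `χ(x)^{#Aut(E/F)} = 1` for
every idele `x` (as `x^{#Aut(E/F)}` is a norm). [folklore] -/
theorem _root_.Literature.NumberTheory.GaloisRepresentations.HeckeCharacter.IsTrivialOnNormGroup.apply_pow_card {χ : Literature.NumberTheory.GaloisRepresentations.HeckeCharacter F}
    (h : χ.IsTrivialOnNormGroup E) (x : (AdeleRing (𝓞 F) F)ˣ) :
    χ x ^ Fintype.card (E ≃ₐ[F] E) = 1 := by
  rw [← map_pow]
  exact h _ (pow_card_mem_normGroup F E x)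

/-- A character trivial on the norm group satisfies `χ ^ #Aut(E/F) = 1`. [folklore] -/
theorem _root_.Literature.NumberTheory.GaloisRepresentations.HeckeCharacter.IsTrivialOnNormGroup.pow_card {χ : Literature.NumberTheory.GaloisRepresentations.HeckeCharacter F}
    (h : χ.IsTrivialOnNormGroup E) : χ ^ Fintype.card (E ≃ₐ[F] E) = 1 :=
  Literature.NumberTheory.GaloisRepresentations.HeckeCharacter.ext fun x => by rw [Literature.NumberTheory.GaloisRepresentations.HeckeCharacter.pow_apply, Literature.NumberTheory.GaloisRepresentations.HeckeCharacter.one_apply,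
    h.apply_pow_card]

/-- A character trivial on the norm group has finite order. [folklore] -/
theorem _root_.Literature.NumberTheory.GaloisRepresentations.HeckeCharacter.IsTrivialOnNormGroup.isFiniteOrder {χ : Literature.NumberTheory.GaloisRepresentations.HeckeCharacter F}
    (h : χ.IsTrivialOnNormGroup E) : χ.IsFiniteOrder :=
  isOfFinOrder_iff_pow_eq_one.mpr ⟨Fintype.card (E ≃ₐ[F] E), Fintype.card_pos, h.pow_card⟩

/-- A character trivial on the norm group is unitary. [folklore] -/
theorem _root_.Literature.NumberTheory.GaloisRepresentations.HeckeCharacter.IsTrivialOnNormGroup.isUnitary {χ : Literature.NumberTheory.GaloisRepresentations.HeckeCharacter F}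
    (h : χ.IsTrivialOnNormGroup E) : χ.IsUnitary :=
  h.isFiniteOrder.isUnitary

/-- A class-field character has finite order. [folklore] -/
theorem _root_.Literature.NumberTheory.GaloisRepresentations.HeckeCharacter.IsClassFieldCharacter.isFiniteOrder {η : Literature.NumberTheory.GaloisRepresentations.HeckeCharacter F}
    (h : η.IsClassFieldCharacter E) : η.IsFiniteOrder :=
  h.isTrivialOnNormGroup.isFiniteOrder

/-- A class-field character is unitary. [folklore] -/
theorem _root_.Literature.NumberTheory.GaloisRepresentations.HeckeCharacter.IsClassFieldCharacter.isUnitary {η : Literature.NumberTheory.GaloisRepresentations.HeckeCharacter F}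
    (h : η.IsClassFieldCharacter E) : η.IsUnitary :=
  h.isTrivialOnNormGroup.isUnitary

/-- Powers of a class-field character are trivial on the norm group. [folklore] -/
theorem _root_.Literature.NumberTheory.GaloisRepresentations.HeckeCharacter.IsClassFieldCharacter.pow_isTrivialOnNormGroup
    {η : Literature.NumberTheory.GaloisRepresentations.HeckeCharacter F} (h : η.IsClassFieldCharacter E) (i : ℕ) : (η ^ i).IsTrivialOnNormGroup E :=
  h.isTrivialOnNormGroup.pow i

/-- A non-trivial extension has a class-field character `≠ 1` (the identity idele `1` lies in the
norm group, and a class-field character vanishes *exactly* there; if `η = 1` then every idele is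
in the norm group) — recorded in the usable form: if `η` is a class-field character and some
idele lies outside the norm group, then `η ≠ 1`. [folklore] -/
theorem _root_.Literature.NumberTheory.GaloisRepresentations.HeckeCharacter.IsClassFieldCharacter.ne_one {η : Literature.NumberTheory.GaloisRepresentations.HeckeCharacter F}
    (h : η.IsClassFieldCharacter E) {x : (AdeleRing (𝓞 F) F)ˣ} (hx : x ∉ normGroup F E) : η ≠ 1 := by
  rintro rfl
  exact hx ((h x).mp rfl)

end ClassFieldCharacter

end Literature.NumberTheory.Automorphic
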